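import Summits.ValiantsHypothesis.ValiantsHypothesis.Theses.StableRankCancellation
import Literature.Computability.AlgebraicComplexity.NWDesignPolynomialVNP

/-!
# StableRankCancellation, support item `DesignInVNP` (stmt-ValiantsHypothesis-10612) — PROVED

Route `StableRankCancellation` of `ValiantsHypothesis`, support item `DesignInVNP` (card K8): the
bundled Reed–Solomon design family `m ↦ NW_{q,d,k}`, `q = m+1`, `d = ⌊log₂ q⌋`, `k = ⌊d/2⌋`, lies in
`VNP ℂ`.  By the Literature file `NWDesignPolynomialVNP.lean` the family is, term by term, the
Boolean sum of the explicit witness `nwWitness q d k` over `k·q` one-hot Boolean variables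
(`boolSum_nwWitness`), whose number of variables, degree and circuit complexity are polynomial in
`q + k + d + 1 ≤ 4(m+1)` (`totalDegree_nwWitness_le`, `complexity_nwWitness_le`); Bürgisser's
Def. 2.5 (`IsVNPFamily`) and the bundling bridge `mem_VNP_ofFintype_iff_holds` conclude.
Honest framing: the route's cruxes (`MinCutStableRankBound`, …) are open; VP ≠ VNP is NOT proved
and nothing here is progress on it.
-/

noncomputable section

-- the summit and the problem share the name `ValiantsHypothesis` (D-0017 single-conjunct layout)
set_option linter.dupNamespace false

namespace Summit.ValiantsHypothesis.ValiantsHypothesis.Theorems.StableRankCancellation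

open Literature.Computability.AlgebraicComplexity

/-- `⌊log₂ (m+1)⌋ ≤ m + 1`. -/
theorem log_le (m : ℕ) : Nat.log 2 (m + 1) ≤ m + 1 :=
  (Nat.log_lt_self 2 (Nat.succ_ne_zero m)).le

/-- The parameter sum `q + k + d + 1 ≤ 4 (m+1)` for `q = m+1`, `d = ⌊log₂ q⌋`, `k = ⌊d/2⌋`. -/
theorem paramSum_le (m : ℕ) :
    (m + 1) + Nat.log 2 (m + 1) / 2 + Nat.log 2 (m + 1) + 1 ≤ 4 * (m + 1) := by
  have h := log_le m
  have h2 : Nat.log 2 (m + 1) / 2 ≤ m + 1 := (Nat.div_le_self _ _).trans h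
  omega

/-- **`DesignInVNP` (stmt-ValiantsHypothesis-10612):** the Reed–Solomon design family is in
`VNP ℂ`, with the explicit one-hot/character witness of `NWDesignPolynomialVNP.lean`. -/
theorem designInVNP_proof :
    Summit.ValiantsHypothesis.ValiantsHypothesis.Theses.StableRankCancellation.DesignInVNP := by
  show PolyFamily.ofFintype (k := ℂ)
      (σ := fun m : ℕ => Σ _ : Fin (Nat.log 2 (m + 1)), ZMod (m + 1))
      (fun m : ℕ => nwDesign (m + 1) (Nat.log 2 (m + 1)) (Nat.log 2 (m + 1) / 2)) ∈ VNP ℂ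
  refine (mem_VNP_ofFintype_iff_holds _).2 ⟨⟨?_, ?_⟩, fun m => Nat.log 2 (m + 1) / 2 * (m + 1),
    fun m => nwWitness (m + 1) (Nat.log 2 (m + 1)) (Nat.log 2 (m + 1) / 2), ⟨⟨?_, ?_⟩, ?_⟩,
    fun m => (boolSum_nwWitness).symm⟩
  · -- number of variables of the design family: `d q ≤ (m+1)²`
    refine (IsPBounded.iff_exists_le_mul_succ_pow _).2 ⟨1, 2, fun m => ?_⟩
    have h := log_le m
    simp only [Fintype.card_sigma, ZMod.card, Finset.sum_const, Finset.card_univ, Fintype.card_fin,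
      smul_eq_mul]
    nlinarith
  · -- degree of the design family: `≤ d ≤ m + 1`
    refine (IsPBounded.iff_exists_le_mul_succ_pow _).2 ⟨1, 1, fun m => ?_⟩
    have h := log_le m
    have := totalDegree_nwDesign_le (m + 1) (Nat.log 2 (m + 1)) (Nat.log 2 (m + 1) / 2)
    dsimp only
    rw [pow_one, one_mul]
    omega
  · -- number of variables of the witness: `d q + k q ≤ 2 (m+1)²`
    refine (IsPBounded.iff_exists_le_mul_succ_pow _).2 ⟨2, 2, fun m => ?_⟩
    have h := log_le m
    have h2 : Nat.log 2 (m + 1) / 2 ≤ m + 1 := (Nat.div_le_self _ _).trans h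
    simp only [Fintype.card_sum, Fintype.card_sigma, ZMod.card, Finset.sum_const, Finset.card_univ,
      Fintype.card_fin, smul_eq_mul]
    nlinarith
  · -- degree of the witness: `≤ 2 (4(m+1))³`
    refine (IsPBounded.iff_exists_le_mul_succ_pow _).2 ⟨2 * 4 ^ 3, 3, fun m => ?_⟩
    dsimp only
    refine (totalDegree_nwWitness_le _ _ _).trans ?_
    have h := paramSum_le m
    calc 2 * (m + 1 + Nat.log 2 (m + 1) / 2 + Nat.log 2 (m + 1) + 1) ^ 3
        ≤ 2 * (4 * (m + 1)) ^ 3 := by gcongr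
      _ = 2 * 4 ^ 3 * (m + 1) ^ 3 := by ring
  · -- complexity of the witness: `≤ 17 (4(m+1))⁵`
    refine (IsPBounded.iff_exists_le_mul_succ_pow _).2 ⟨17 * 4 ^ 5, 5, fun m => ?_⟩
    dsimp only
    refine (complexity_nwWitness_le _ _ _).trans ?_
    have h := paramSum_le m
    calc 17 * (m + 1 + Nat.log 2 (m + 1) / 2 + Nat.log 2 (m + 1) + 1) ^ 5
        ≤ 17 * (4 * (m + 1)) ^ 5 := by gcongr
      _ = 17 * 4 ^ 5 * (m + 1) ^ 5 := by ring

end Summit.ValiantsHypothesis.ValiantsHypothesis.Theorems.StableRankCancellation
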